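import Summits.HodgeConjecture.HodgeConjecture.Theorems.F0P3AnisotropicSmoothTraceConvSpan   -- ★ S1 (p832374 ∕ ED. 2 p832662): «SSG» from ★ `UnitaryGroup.AdelicTestConvSpan` by name
import Literature.NumberTheory.Automorphic.UnitaryGroupArchTestConvSpanHolds                  -- ★ B7 (road «DM∞»): `UnitaryGroup.adelicTestConvSpan_holds` (Dixmier–Malliavin, weak form, PROVED)
import HarnessLib

/-!
# «SSG» HOLDS — letter #100 `UnitaryGroup.AnisotropicSmoothTraceExpansion` proved in the tree, hypothesis-free

Cell `hodgecm-mathlib`, floor 0, programme P3 «U3-mult», crux H413 (`stmt-HodgeConjecture-24833`, supports).  THEOREM ONLY (no definition, no named fact,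
no instance, no notation, no `sorry`); namespace `Summit.HodgeConjecture.HodgeConjecture.Cruxes.H413.F0P3AnisotropicSmoothTraceExpansionHolds`.

THE JUNCTION.  ★ `F0P3AnisotropicSmoothTraceConvSpan.anisotropicSmoothTraceExpansion_of_adelicTestConvSpan` (S1: the spectral side `θ_{G′}(F) = Σ m(π′) tr π′(F)` of the
anisotropic inner form at every `F` in the CONVOLUTION SPAN, clause by clause over ★ `AutomorphicQuotientSpectralExpansionPolar`, reduced to the weak adelic
Dixmier–Malliavin letter ★ `UnitaryGroup.AdelicTestConvSpan L N H ν`) composed with ★ `UnitaryGroup.adelicTestConvSpan_holds` (road «DM∞», brick B7: the weak adelic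
Dixmier–Malliavin factorisation PROVED — finite places by compact-open idempotents, the archimedean place by Dixmier–Malliavin on the real group `U(H)(L⁺ ⊗ ℝ)` in
Cayley ∕ second-kind coordinates, bricks B1–B7).  RESULT: the INVENTORY letter #100 «SSG» ★ `UnitaryGroup.AnisotropicSmoothTraceExpansion L N H μ ν hanis`
([Rogawski1990, §14.5 p. 237]: «since `G′` is anisotropic, `T_{G′}(f′)` is the trace of `ρ(f′)` on `L(G′)` … `θ_{G′}(f′) = Σ m(π) Tr(π(f′))`») holds for EVERY CM field `L`,
every `N`, every anisotropic hermitian `H`, every automorphic measure `μ` and every Haar measure `ν` on the Borel σ-algebra — under the letter's own binders and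
nothing else.

* `anisotropicSmoothTraceExpansion_holds` — the hypothesis-free letter (one term).

JUNK AUDIT: none possible — the statement IS the letter ★ p824780 with its binders; `hanis` is the letter's anisotropy text (T1's `IsAnisotropic L H` unfolds to it,
so the closer's `StubSSG` is `fun L _ _ _ H _ _ μ _ ν _ hanis => anisotropicSmoothTraceExpansion_holds L 3 H μ ν hanis`).

HONEST LABEL: HC_CM is proved only modulo the printed citations until rung 0 closes; this file turns ONE of them (#100 «SSG», with its residuals «DMa»∕«DMarch») into a
theorem of the tree.  It files nothing new on the books beyond what ★ B7 already pays; it is the by-name form consumers cite.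

## References
* J. D. Rogawski, *Automorphic Representations of Unitary Groups in Three Variables*, Ann. of Math. Stud. 123 (1990), §14.5 p. 237, §14.2 p. 233 [Rogawski1990].
* J. Dixmier, P. Malliavin, *Factorisations de fonctions et de vecteurs indéfiniment différentiables*, Bull. Sci. Math. (2) 102 (1978) 305–330, Thm. 3.1
  [DixmierMalliavin1978].
* I. M. Gelfand, M. I. Graev, I. I. Piatetski-Shapiro, *Representation Theory and Automorphic Functions* (1969), Ch. 1 §2 [GelfandGraevPiatetskiShapiro1969].
-/

set_option autoImplicit false
set_option linter.dupNamespace false   -- `Summit.HodgeConjecture.HodgeConjecture.…` (summit = sub-problem, D-0017)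

noncomputable section

open MeasureTheory Measure NumberField
open Literature.NumberTheory.Automorphic Literature.NumberTheory.Automorphic.UnitaryGroup

namespace Summit.HodgeConjecture.HodgeConjecture.Cruxes.H413.F0P3AnisotropicSmoothTraceExpansionHolds

/-- **«SSG» HOLDS** [Rogawski1990, §14.5 p. 237]: for a CM field `L`, an anisotropic hermitian `H ∈ M_N(L)`, an automorphic measure `μ` on `U(H)(L⁺)∖U(H)(𝔸_{L⁺})` and a
Haar measure `ν` on the Borel σ-algebra of `U(H)(𝔸_{L⁺})`, the spectral side of the anisotropic inner form at every smooth pure tensor `F` is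
`θ_{G′}(F) = Σ_{π′} m(π′) tr π′(F)`, absolutely convergent, basis- and realisation-free — the letter ★ `UnitaryGroup.AnisotropicSmoothTraceExpansion L N H μ ν hanis`
with NO hypothesis beyond its binders (★ S1 `anisotropicSmoothTraceExpansion_of_adelicTestConvSpan` ∘ ★ B7 `adelicTestConvSpan_holds`).
[cite: Rogawski1990, §14.5 p. 237] [cite: DixmierMalliavin1978, Thm. 3.1] [cite: GelfandGraevPiatetskiShapiro1969, Ch. 1 §2] -/
theorem anisotropicSmoothTraceExpansion_holds (L : Type) [Field L] [NumberField L] [IsCMField L] (N : ℕ) (H : Matrix (Fin N) (Fin N) L)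
    [MeasurableSpace (cmDatum L N H).Adelic] [BorelSpace (cmDatum L N H).Adelic]
    (μ : Measure (cmDatum L N H).automorphicQuotient) [(cmDatum L N H).IsAutomorphicMeasure μ]
    (ν : Measure (cmDatum L N H).Adelic) [ν.IsHaarMeasure]
    (hanis : ∀ x : Fin N → L, Literature.AlgebraicGeometry.ShimuraVarieties.hermForm (cmConjRingHom L) H x x = 0 → x = 0) :
    AnisotropicSmoothTraceExpansion L N H μ ν hanis :=
  F0P3AnisotropicSmoothTraceConvSpan.anisotropicSmoothTraceExpansion_of_adelicTestConvSpan L N H μ ν hanis (adelicTestConvSpan_holds L N H ν)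

end Summit.HodgeConjecture.HodgeConjecture.Cruxes.H413.F0P3AnisotropicSmoothTraceExpansionHolds

end
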